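import Mathlib
import HarnessLib
import Summits.Ventures.LatticeQCDFlow.Exactness.SphereHMCExact

/-!
# The normal momentum component is inert: the sphere HMC configuration chain depends only on the tangential momentum law

HONEST FRAMING: exact (Metropolis-corrected) sampling algorithms for lattice gauge theory;
figures of merit are autocorrelation/cost numbers at stated couplings and volumes; no
continuum-physics claim.

Venture `LatticeQCDFlow` (cell pub-lqcd), topic `Exactness`; FANOUT row 7 (`s0-cpn-null`: the
S0-D1 rung — 2D CP⁹ HMC/THMC with the E–S §2.2 molecular dynamics).  NEW WORK of the cell over
the tree's `SphereHMCExact.lean` (`leapfrogPerm`, `flipPerm`, `sphere_hmc_gaussian_exact`: HMC on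
the site sphere with AMBIENT Gaussian momenta is exact), `SphereDriftLift.lean` (tangential/normal
bookkeeping: `inner_ambientKick`, `inner_ambientDrift`, `tangentialPart_ambientDrift`,
`norm_sq_eq_tangential_add_normal`), `InvolutiveMetropolis.lean` (`involMH_apply`) and
`MomentumRefresh.lean` (`refreshUpdate_apply'`).  Nothing is cited as a fact.  Printed
counterpart, NAMED ONLY: Engel–Schaefer, Comput. Phys. Commun. 182 (2011) 2107, §2.2 (momenta
`π_n` TANGENT to the site sphere, `|π_n|²/2` kinetic energy).

`SphereHMCExact.lean` proves exactness for momenta refreshed in the ambient `ℝ^d` and an integrator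
that carries the normal component `⟪x, p⟫` along.  The code draws TANGENT momenta.  This file closes
the gap honestly: for a tangent force field and the Gaussian kinetic energy `‖p‖²/2`, the
configuration marginal of one phase-space update from `(x, p)` equals the one from
`(x, p − ⟪x,p⟫x)` (`sphereHMC_fst_apply_eq_tangentialize`), hence the configuration kernel with
momenta refreshed from ANY law `μP` is the `μP`-integral of the phase-space kernel over the
TANGENTIAL projections only (`sphereHMC_config_apply_eq_lintegral_tangential`) — the image of `μP`
under `p ↦ p − ⟪x,p⟫x`, which for the standard Gaussian of `ℝ^d` is the tangent-space Gaussian the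
code samples.  So the exact chain of `sphere_hmc_gaussian_exact` IS the E–S configuration chain.

## Content (`m` finite, `E = EuclideanSpace ℝ m`, `S` its unit sphere; `F` tangent on `S`)

* `tangentialize (x, p) = (x, p − ⟪x,p⟫x)` and its bookkeeping; **`tangentialize_ambientDrift`**,
  **`tangentialize_ambientKick`**, `tangentialize_ambientFlip`, `tangentialize_leapfrogPerm_pow`,
  **`tangentialize_sphereProposal`** — the proposal COMMUTES with tangentialization.
* `inner_sq_leapfrogPerm_pow`, `inner_sq_sphereProposal` — `⟪x,p⟫²` is conserved by the proposal;
  **`energyDiff_sphereProposal_tangentialize`** — `ΔH` does not see the normal component.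
* **`sphereHMC_fst_apply_eq_tangentialize`** — `K((x,p), A × E) = K((x, p − ⟪x,p⟫x), A × E)` for the
  Metropolis phase-space kernel `K = involMH (flip ∘ leapfrog^n) (S + ‖·‖²/2)`.
* **`sphereHMC_config_apply_eq_lintegral_tangential`** — the configuration kernel
  `refreshUpdate K μP` as an integral against `μP.map (p ↦ p − ⟪u,p⟫u)`.
* `refreshUpdateK κ η` — refresh–update–forget with a POSITION-DEPENDENT auxiliary law (a Markov
  kernel `η`; HMC on a manifold), `refreshUpdateK_const` (= `refreshUpdate` for a constant law),
  `refreshUpdateK_apply'`, **`refreshUpdateK_invariant`** (exact whenever `κ` preserves `μ ⊗ₘ η`);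
  `tangentMomentumLaw μP` (the kernel `u ↦ μP.map (p ↦ p − ⟪u,p⟫u)`), `tangentMomentumLaw_apply`;
  **`sphereHMC_config_eq_tangentRefresh`** — THE KERNEL EQUALITY: sphere HMC with ambient momenta
  `μP` = sphere HMC with tangent momenta `tangentMomentumLaw μP` on configurations; hence
  **`sphere_hmc_tangentGaussian_exact`** — the chain the CP(N−1) code runs (tangent Gaussian
  momenta, E–S leapfrog, Metropolis, momenta forgotten) leaves `e^{−S}·uniformSphere` invariant.

NOT CLAIMED: a closed form for the tangent-space image of the Gaussian (it is the law the code
samples by projecting a standard normal vector, by definition of that sampler); non-tangent forces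
(then the normal component does enter `ΔH`); the lattice version of this identification (sitewise
bookkeeping over `SphereLatticeHMCExact.lean`); anything quantitative.
-/

noncomputable section

namespace Summit.Ventures.LatticeQCDFlow.Exactness

open MeasureTheory Measure Metric Set Real ProbabilityTheory
open scoped ENNReal InnerProductSpace

/-! ## The configuration chain is driven by the tangential momentum law -/

section Tangential

variable {m : Type*} [Fintype m] [DecidableEq m]

/-- Project an ambient phase-space point to the tangent bundle: drop the normal momentum component. -/
def tangentialize (z : (sphere (0 : EuclideanSpace ℝ m) 1) × (EuclideanSpace ℝ m)) : (sphere (0 : EuclideanSpace ℝ m) 1) × (EuclideanSpace ℝ m) := (z.1, tangentialPart z)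

omit [DecidableEq m] in
/-- A tangent momentum is its own tangential part. -/
theorem tangentialPart_of_inner_eq_zero {x : (sphere (0 : EuclideanSpace ℝ m) 1)} {v : (EuclideanSpace ℝ m)} (h : ⟪(x : (EuclideanSpace ℝ m)), v⟫_ℝ = 0) :
    tangentialPart (x, v) = v := by
  simp only [tangentialPart, h, zero_smul, sub_zero]

omit [DecidableEq m] in
/-- `tangentialize` fixes the position. -/
@[simp] theorem tangentialize_fst (z : (sphere (0 : EuclideanSpace ℝ m) 1) × (EuclideanSpace ℝ m)) : (tangentialize z).1 = z.1 := rfl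

omit [DecidableEq m] in
/-- The tangential part of a tangentialized point is unchanged. -/
@[simp] theorem tangentialPart_tangentialize (z : (sphere (0 : EuclideanSpace ℝ m) 1) × (EuclideanSpace ℝ m)) :
    tangentialPart (tangentialize z) = tangentialPart z :=
  tangentialPart_of_inner_eq_zero (inner_tangentialPart z)

omit [DecidableEq m] in
/-- … and it has no normal component. -/
theorem inner_tangentialize (z : (sphere (0 : EuclideanSpace ℝ m) 1) × (EuclideanSpace ℝ m)) :
    ⟪((tangentialize z).1 : (EuclideanSpace ℝ m)), (tangentialize z).2⟫_ℝ = 0 :=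
  inner_tangentialPart z

omit [DecidableEq m] in
/-- The drift commutes with tangentialization. -/
theorem tangentialize_ambientDrift (t : ℝ) (z : (sphere (0 : EuclideanSpace ℝ m) 1) × (EuclideanSpace ℝ m)) :
    tangentialize (ambientDrift t z) = ambientDrift t (tangentialize z) := by
  refine Prod.ext ?_ ?_
  · -- positions: both are `(geodesicDrift t (x, tangentialPart z)).1`
    apply Subtype.ext
    change (geodesicDrift t ((z.1 : (EuclideanSpace ℝ m)), tangentialPart z)).1 =
      (geodesicDrift t ((z.1 : (EuclideanSpace ℝ m)), tangentialPart (tangentialize z))).1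
    rw [tangentialPart_tangentialize]
  · change tangentialPart (ambientDrift t z) =
      (geodesicDrift t ((z.1 : (EuclideanSpace ℝ m)), tangentialPart (tangentialize z))).2 +
        ⟪((tangentialize z).1 : (EuclideanSpace ℝ m)), (tangentialize z).2⟫_ℝ •
          (geodesicDrift t ((z.1 : (EuclideanSpace ℝ m)), tangentialPart (tangentialize z))).1
    rw [tangentialPart_ambientDrift, tangentialPart_tangentialize, inner_tangentialize, zero_smul, add_zero]

omit [DecidableEq m] in
/-- A TANGENT kick commutes with tangentialization. -/
theorem tangentialize_ambientKick {F : (EuclideanSpace ℝ m) → (EuclideanSpace ℝ m)} (hF : ∀ x : (sphere (0 : EuclideanSpace ℝ m) 1), ⟪(x : (EuclideanSpace ℝ m)), F x⟫_ℝ = 0) (δ : ℝ)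
    (z : (sphere (0 : EuclideanSpace ℝ m) 1) × (EuclideanSpace ℝ m)) : tangentialize (ambientKick F δ z) = ambientKick F δ (tangentialize z) := by
  refine Prod.ext rfl ?_
  change tangentialPart (ambientKick F δ z) = tangentialPart z + δ • F z.1
  simp only [tangentialPart, ambientKick, inner_add_right, real_inner_smul_right, hF, mul_zero, add_zero]
  abel

omit [DecidableEq m] in
/-- The flip commutes with tangentialization. -/
theorem tangentialize_ambientFlip (z : (sphere (0 : EuclideanSpace ℝ m) 1) × (EuclideanSpace ℝ m)) :
    tangentialize (ambientFlip z) = ambientFlip (tangentialize z) := by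
  refine Prod.ext rfl ?_
  change tangentialPart (ambientFlip z) = -tangentialPart z
  simp only [tangentialPart, ambientFlip, inner_neg_right, neg_smul, neg_sub', sub_neg_eq_add]

omit [DecidableEq m] in
/-- The leapfrog trajectory commutes with tangentialization (tangent force). -/
theorem tangentialize_leapfrogPerm_pow {F : (EuclideanSpace ℝ m) → (EuclideanSpace ℝ m)} (hF : ∀ x : (sphere (0 : EuclideanSpace ℝ m) 1), ⟪(x : (EuclideanSpace ℝ m)), F x⟫_ℝ = 0) (δ : ℝ) :
    ∀ (n : ℕ) (z : (sphere (0 : EuclideanSpace ℝ m) 1) × (EuclideanSpace ℝ m)),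
      tangentialize ((leapfrogPerm F δ ^ n) z) = (leapfrogPerm F δ ^ n) (tangentialize z)
  | 0, z => by simp
  | n + 1, z => by
      rw [pow_succ', Equiv.Perm.mul_apply, Equiv.Perm.mul_apply]
      have hstep : ∀ w : (sphere (0 : EuclideanSpace ℝ m) 1) × (EuclideanSpace ℝ m), tangentialize (leapfrogPerm F δ w) = leapfrogPerm F δ (tangentialize w) := by
        intro w
        change tangentialize (ambientKick F (δ / 2) (ambientDrift δ (ambientKick F (δ / 2) w))) =
          ambientKick F (δ / 2) (ambientDrift δ (ambientKick F (δ / 2) (tangentialize w)))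
        rw [tangentialize_ambientKick hF, tangentialize_ambientDrift, tangentialize_ambientKick hF]
      rw [hstep, tangentialize_leapfrogPerm_pow hF δ n z]

omit [DecidableEq m] in
/-- **The proposal commutes with tangentialization** (tangent force): position and tangential
momentum of the proposed state do not depend on the normal component of the start. -/
theorem tangentialize_sphereProposal {F : (EuclideanSpace ℝ m) → (EuclideanSpace ℝ m)} (hF : ∀ x : (sphere (0 : EuclideanSpace ℝ m) 1), ⟪(x : (EuclideanSpace ℝ m)), F x⟫_ℝ = 0) (δ : ℝ) (n : ℕ)
    (z : (sphere (0 : EuclideanSpace ℝ m) 1) × (EuclideanSpace ℝ m)) :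
    tangentialize (((flipPerm : Equiv.Perm ((sphere (0 : EuclideanSpace ℝ m) 1) × (EuclideanSpace ℝ m))) * leapfrogPerm F δ ^ n) z) =
      ((flipPerm : Equiv.Perm ((sphere (0 : EuclideanSpace ℝ m) 1) × (EuclideanSpace ℝ m))) * leapfrogPerm F δ ^ n) (tangentialize z) := by
  rw [Equiv.Perm.mul_apply, Equiv.Perm.mul_apply]
  change tangentialize (ambientFlip ((leapfrogPerm F δ ^ n) z)) = ambientFlip ((leapfrogPerm F δ ^ n) (tangentialize z))
  rw [tangentialize_ambientFlip, tangentialize_leapfrogPerm_pow hF δ n z]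

omit [DecidableEq m] in
/-- The normal component is conserved in square along the trajectory (tangent force). -/
theorem inner_sq_leapfrogPerm_pow {F : (EuclideanSpace ℝ m) → (EuclideanSpace ℝ m)} (hF : ∀ x : (sphere (0 : EuclideanSpace ℝ m) 1), ⟪(x : (EuclideanSpace ℝ m)), F x⟫_ℝ = 0) (δ : ℝ) :
    ∀ (n : ℕ) (z : (sphere (0 : EuclideanSpace ℝ m) 1) × (EuclideanSpace ℝ m)),
      ⟪(((leapfrogPerm F δ ^ n) z).1 : (EuclideanSpace ℝ m)), ((leapfrogPerm F δ ^ n) z).2⟫_ℝ = ⟪(z.1 : (EuclideanSpace ℝ m)), z.2⟫_ℝ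
  | 0, z => by simp
  | n + 1, z => by
      rw [pow_succ', Equiv.Perm.mul_apply]
      have hstep : ∀ w : (sphere (0 : EuclideanSpace ℝ m) 1) × (EuclideanSpace ℝ m), ⟪((leapfrogPerm F δ w).1 : (EuclideanSpace ℝ m)), (leapfrogPerm F δ w).2⟫_ℝ = ⟪(w.1 : (EuclideanSpace ℝ m)), w.2⟫_ℝ := by
        intro w
        change ⟪((ambientKick F (δ / 2) (ambientDrift δ (ambientKick F (δ / 2) w))).1 : (EuclideanSpace ℝ m)),
          (ambientKick F (δ / 2) (ambientDrift δ (ambientKick F (δ / 2) w))).2⟫_ℝ = _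
        rw [inner_ambientKick hF, inner_ambientDrift, inner_ambientKick hF]
      rw [hstep, inner_sq_leapfrogPerm_pow hF δ n z]

omit [DecidableEq m] in
/-- … and negated by the final flip: its square is conserved by the proposal. -/
theorem inner_sq_sphereProposal {F : (EuclideanSpace ℝ m) → (EuclideanSpace ℝ m)} (hF : ∀ x : (sphere (0 : EuclideanSpace ℝ m) 1), ⟪(x : (EuclideanSpace ℝ m)), F x⟫_ℝ = 0) (δ : ℝ) (n : ℕ)
    (z : (sphere (0 : EuclideanSpace ℝ m) 1) × (EuclideanSpace ℝ m)) :
    ⟪((((flipPerm : Equiv.Perm ((sphere (0 : EuclideanSpace ℝ m) 1) × (EuclideanSpace ℝ m))) * leapfrogPerm F δ ^ n) z).1 : (EuclideanSpace ℝ m)),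
        (((flipPerm : Equiv.Perm ((sphere (0 : EuclideanSpace ℝ m) 1) × (EuclideanSpace ℝ m))) * leapfrogPerm F δ ^ n) z).2⟫_ℝ ^ 2 = ⟪(z.1 : (EuclideanSpace ℝ m)), z.2⟫_ℝ ^ 2 := by
  rw [Equiv.Perm.mul_apply]
  change ⟪(((leapfrogPerm F δ ^ n) z).1 : (EuclideanSpace ℝ m)), -((leapfrogPerm F δ ^ n) z).2⟫_ℝ ^ 2 = _
  rw [inner_neg_right, neg_sq, inner_sq_leapfrogPerm_pow hF δ n z]

omit [DecidableEq m] in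
/-- **The energy change seen by the Metropolis test does not depend on the normal component**
(Gaussian kinetic energy `‖p‖²/2`, tangent force). -/
theorem energyDiff_sphereProposal_tangentialize {F : (EuclideanSpace ℝ m) → (EuclideanSpace ℝ m)} (hF : ∀ x : (sphere (0 : EuclideanSpace ℝ m) 1), ⟪(x : (EuclideanSpace ℝ m)), F x⟫_ℝ = 0)
    (δ : ℝ) (n : ℕ) (S : (sphere (0 : EuclideanSpace ℝ m) 1) → ℝ) (z : (sphere (0 : EuclideanSpace ℝ m) 1) × (EuclideanSpace ℝ m)) :
    (S z.1 + ‖z.2‖ ^ 2 / 2) -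
        (S (((flipPerm : Equiv.Perm ((sphere (0 : EuclideanSpace ℝ m) 1) × (EuclideanSpace ℝ m))) * leapfrogPerm F δ ^ n) z).1 +
          ‖(((flipPerm : Equiv.Perm ((sphere (0 : EuclideanSpace ℝ m) 1) × (EuclideanSpace ℝ m))) * leapfrogPerm F δ ^ n) z).2‖ ^ 2 / 2) =
      (S (tangentialize z).1 + ‖(tangentialize z).2‖ ^ 2 / 2) -
        (S (((flipPerm : Equiv.Perm ((sphere (0 : EuclideanSpace ℝ m) 1) × (EuclideanSpace ℝ m))) * leapfrogPerm F δ ^ n) (tangentialize z)).1 +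
          ‖(((flipPerm : Equiv.Perm ((sphere (0 : EuclideanSpace ℝ m) 1) × (EuclideanSpace ℝ m))) * leapfrogPerm F δ ^ n) (tangentialize z)).2‖ ^ 2 / 2) := by
  set Ψ : Equiv.Perm ((sphere (0 : EuclideanSpace ℝ m) 1) × (EuclideanSpace ℝ m)) := (flipPerm : Equiv.Perm ((sphere (0 : EuclideanSpace ℝ m) 1) × (EuclideanSpace ℝ m))) * leapfrogPerm F δ ^ n with hΨ
  have hcomm : tangentialize (Ψ z) = Ψ (tangentialize z) := tangentialize_sphereProposal hF δ n z
  -- positions agree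
  have hpos : (Ψ (tangentialize z)).1 = (Ψ z).1 := by
    rw [← hcomm]; rfl
  -- kinetic energies split into tangential + normal parts
  have e1 := norm_sq_eq_tangential_add_normal z
  have e2 := norm_sq_eq_tangential_add_normal (Ψ z)
  have e3 := norm_sq_eq_tangential_add_normal (tangentialize z)
  have e4 := norm_sq_eq_tangential_add_normal (Ψ (tangentialize z))
  have t3 : tangentialPart (tangentialize z) = tangentialPart z := tangentialPart_tangentialize z
  have t4 : tangentialPart (Ψ (tangentialize z)) = tangentialPart (Ψ z) := by
    rw [← hcomm]; exact tangentialPart_tangentialize _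
  have n2 := inner_sq_sphereProposal hF δ n z
  have n3 : ⟪((tangentialize z).1 : (EuclideanSpace ℝ m)), (tangentialize z).2⟫_ℝ = 0 := inner_tangentialize z
  have n4 := inner_sq_sphereProposal hF δ n (tangentialize z)
  rw [← hΨ] at n2 n4
  rw [n3] at n4
  rw [hpos, e1, e2, e3, e4, t3, t4, n2, n4, n3]
  simp only [tangentialize_fst]
  ring

variable [Nonempty m]

/-- **THE NORMAL COMPONENT IS INERT.**  One HMC update on the site sphere (tangent force, Gaussian
kinetic energy), seen on the configuration: started from `(x, p)` it is the same as started from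
`(x, p − ⟪x,p⟫x)` — the configuration marginal of the phase-space kernel factors through the
tangential momentum. -/
theorem sphereHMC_fst_apply_eq_tangentialize (h2 : 2 ≤ Fintype.card m) {S : (sphere (0 : EuclideanSpace ℝ m) 1) → ℝ} (hS : Measurable S)
    {F : (EuclideanSpace ℝ m) → (EuclideanSpace ℝ m)} (hFm : Measurable F) (hF : ∀ x : (sphere (0 : EuclideanSpace ℝ m) 1), ⟪(x : (EuclideanSpace ℝ m)), F x⟫_ℝ = 0) (δ : ℝ) (n : ℕ)
    (z : (sphere (0 : EuclideanSpace ℝ m) 1) × (EuclideanSpace ℝ m)) {A : Set (sphere (0 : EuclideanSpace ℝ m) 1)} (hA : MeasurableSet A) :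
    involMH ⇑((flipPerm : Equiv.Perm ((sphere (0 : EuclideanSpace ℝ m) 1) × (EuclideanSpace ℝ m))) * leapfrogPerm F δ ^ n)
        (measurePreserving_sphereProposal h2 hFm δ n).measurable
        (fun w : (sphere (0 : EuclideanSpace ℝ m) 1) × (EuclideanSpace ℝ m) => S w.1 + ‖w.2‖ ^ 2 / 2) z (Prod.fst ⁻¹' A) =
      involMH ⇑((flipPerm : Equiv.Perm ((sphere (0 : EuclideanSpace ℝ m) 1) × (EuclideanSpace ℝ m))) * leapfrogPerm F δ ^ n)
        (measurePreserving_sphereProposal h2 hFm δ n).measurable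
        (fun w : (sphere (0 : EuclideanSpace ℝ m) 1) × (EuclideanSpace ℝ m) => S w.1 + ‖w.2‖ ^ 2 / 2) (tangentialize z) (Prod.fst ⁻¹' A) := by
  have hH : Measurable fun w : (sphere (0 : EuclideanSpace ℝ m) 1) × (EuclideanSpace ℝ m) => S w.1 + ‖w.2‖ ^ 2 / 2 :=
    (hS.comp measurable_fst).add ((measurable_snd.norm.pow_const 2).div_const 2)
  have hB : MeasurableSet (Prod.fst ⁻¹' A : Set ((sphere (0 : EuclideanSpace ℝ m) 1) × (EuclideanSpace ℝ m))) := measurable_fst hA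
  rw [involMH_apply hH z hB, involMH_apply hH (tangentialize z) hB]
  have hacc : involAcceptE (fun w : (sphere (0 : EuclideanSpace ℝ m) 1) × (EuclideanSpace ℝ m) => S w.1 + ‖w.2‖ ^ 2 / 2)
      ⇑((flipPerm : Equiv.Perm ((sphere (0 : EuclideanSpace ℝ m) 1) × (EuclideanSpace ℝ m))) * leapfrogPerm F δ ^ n) z =
      involAcceptE (fun w : (sphere (0 : EuclideanSpace ℝ m) 1) × (EuclideanSpace ℝ m) => S w.1 + ‖w.2‖ ^ 2 / 2)
      ⇑((flipPerm : Equiv.Perm ((sphere (0 : EuclideanSpace ℝ m) 1) × (EuclideanSpace ℝ m))) * leapfrogPerm F δ ^ n) (tangentialize z) := by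
    simp only [involAcceptE, involAccept]
    rw [energyDiff_sphereProposal_tangentialize hF δ n S z]
  have hpos : (((flipPerm : Equiv.Perm ((sphere (0 : EuclideanSpace ℝ m) 1) × (EuclideanSpace ℝ m))) * leapfrogPerm F δ ^ n) (tangentialize z)).1 =
      (((flipPerm : Equiv.Perm ((sphere (0 : EuclideanSpace ℝ m) 1) × (EuclideanSpace ℝ m))) * leapfrogPerm F δ ^ n) z).1 := by
    rw [← tangentialize_sphereProposal hF δ n z]; rfl
  have key : ∀ w : (sphere (0 : EuclideanSpace ℝ m) 1) × (EuclideanSpace ℝ m), (Prod.fst ⁻¹' A : Set ((sphere (0 : EuclideanSpace ℝ m) 1) × (EuclideanSpace ℝ m))).indicator (1 : (sphere (0 : EuclideanSpace ℝ m) 1) × (EuclideanSpace ℝ m) → ℝ≥0∞) w =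
      A.indicator (1 : (sphere (0 : EuclideanSpace ℝ m) 1) → ℝ≥0∞) w.1 := fun w =>
    Set.indicator_comp_right (Prod.fst : (sphere (0 : EuclideanSpace ℝ m) 1) × (EuclideanSpace ℝ m) → (sphere (0 : EuclideanSpace ℝ m) 1)) (g := (1 : (sphere (0 : EuclideanSpace ℝ m) 1) → ℝ≥0∞))
  rw [hacc, key, key, key, key, hpos, tangentialize_fst]

/-- **The configuration chain is driven by the tangential momentum law only**: the HMC
configuration update from `u` with momenta refreshed from ANY law `μP` on `ℝ^d` equals the
integral of the phase-space kernel over the TANGENTIAL projections `p − ⟪u,p⟫u` of the momenta —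
i.e. over the image law of `μP` on the tangent space at `u` (for the Gaussian `μP` of E–S: the
tangent Gaussian the code draws). -/
theorem sphereHMC_config_apply_eq_lintegral_tangential (h2 : 2 ≤ Fintype.card m) {S : (sphere (0 : EuclideanSpace ℝ m) 1) → ℝ}
    (hS : Measurable S) {F : (EuclideanSpace ℝ m) → (EuclideanSpace ℝ m)} (hFm : Measurable F) (hF : ∀ x : (sphere (0 : EuclideanSpace ℝ m) 1), ⟪(x : (EuclideanSpace ℝ m)), F x⟫_ℝ = 0)
    (δ : ℝ) (n : ℕ) (μP : Measure (EuclideanSpace ℝ m)) [SFinite μP] (u : (sphere (0 : EuclideanSpace ℝ m) 1)) {A : Set (sphere (0 : EuclideanSpace ℝ m) 1)} (hA : MeasurableSet A) :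
    refreshUpdate
        (involMH ⇑((flipPerm : Equiv.Perm ((sphere (0 : EuclideanSpace ℝ m) 1) × (EuclideanSpace ℝ m))) * leapfrogPerm F δ ^ n)
          (measurePreserving_sphereProposal h2 hFm δ n).measurable
          (fun w : (sphere (0 : EuclideanSpace ℝ m) 1) × (EuclideanSpace ℝ m) => S w.1 + ‖w.2‖ ^ 2 / 2)) μP u A =
      ∫⁻ v, involMH ⇑((flipPerm : Equiv.Perm ((sphere (0 : EuclideanSpace ℝ m) 1) × (EuclideanSpace ℝ m))) * leapfrogPerm F δ ^ n)
          (measurePreserving_sphereProposal h2 hFm δ n).measurable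
          (fun w : (sphere (0 : EuclideanSpace ℝ m) 1) × (EuclideanSpace ℝ m) => S w.1 + ‖w.2‖ ^ 2 / 2) (u, v) (Prod.fst ⁻¹' A)
        ∂(μP.map fun p : (EuclideanSpace ℝ m) => tangentialPart (u, p)) := by
  have hT : Measurable fun p : (EuclideanSpace ℝ m) => tangentialPart (u, p) :=
    continuous_tangentialPart.measurable.comp (measurable_const.prodMk measurable_id)
  have hk : Measurable fun v : (EuclideanSpace ℝ m) => involMH ⇑((flipPerm : Equiv.Perm ((sphere (0 : EuclideanSpace ℝ m) 1) × (EuclideanSpace ℝ m))) * leapfrogPerm F δ ^ n)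
      (measurePreserving_sphereProposal h2 hFm δ n).measurable
      (fun w : (sphere (0 : EuclideanSpace ℝ m) 1) × (EuclideanSpace ℝ m) => S w.1 + ‖w.2‖ ^ 2 / 2) (u, v) (Prod.fst ⁻¹' A) :=
    (ProbabilityTheory.Kernel.measurable_coe _ (measurable_fst hA)).comp measurable_prodMk_left
  rw [refreshUpdate_apply' _ _ _ hA, lintegral_map hk hT]
  refine lintegral_congr fun p => ?_
  exact sphereHMC_fst_apply_eq_tangentialize h2 hS hFm hF δ n (u, p) hA

end Tangential

/-! ### Refresh from a position-dependent momentum law; the ambient and the tangent refresh give the same configuration kernel -/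

section KernelRefresh

open ProbabilityTheory

variable {Ω P : Type*} [MeasurableSpace Ω] [MeasurableSpace P]

/-- Refresh–update–forget with a POSITION-DEPENDENT auxiliary law `η u` (HMC on a manifold: the
momentum law lives on the tangent space at `u`): `u ↦ δ_u ⊗ η(u)`, then `κ`, then forget. -/
def refreshUpdateK (κ : ProbabilityTheory.Kernel (Ω × P) (Ω × P)) (η : ProbabilityTheory.Kernel Ω P) :
    ProbabilityTheory.Kernel Ω Ω :=
  ProbabilityTheory.Kernel.map (κ ∘ₖ (ProbabilityTheory.Kernel.id ×ₖ η)) Prod.fst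

/-- With a constant law it is `MomentumRefresh.refreshUpdate`. -/
theorem refreshUpdateK_const (κ : ProbabilityTheory.Kernel (Ω × P) (Ω × P)) (μP : Measure P) :
    refreshUpdateK κ (ProbabilityTheory.Kernel.const Ω μP) = refreshUpdate κ μP := rfl

/-- Set-wise formula: `refreshUpdateK κ η u A = ∫ κ((u, q), A × P) η(u)(dq)`. -/
theorem refreshUpdateK_apply' (κ : ProbabilityTheory.Kernel (Ω × P) (Ω × P)) (η : ProbabilityTheory.Kernel Ω P)
    [ProbabilityTheory.IsSFiniteKernel η] (u : Ω) {A : Set Ω} (hA : MeasurableSet A) :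
    refreshUpdateK κ η u A = ∫⁻ q, κ (u, q) (Prod.fst ⁻¹' A) ∂(η u) := by
  rw [refreshUpdateK, ProbabilityTheory.Kernel.map_apply' _ measurable_fst _ hA,
    ProbabilityTheory.Kernel.comp_apply' _ _ _ (measurable_fst hA), ProbabilityTheory.Kernel.prod_apply,
    ProbabilityTheory.Kernel.id_apply, Measure.dirac_prod,
    lintegral_map (ProbabilityTheory.Kernel.measurable_coe κ (measurable_fst hA)) measurable_prodMk_left]

/-- **Position-dependent auxiliary laws are exact too**: if `κ` leaves `μ ⊗ₘ η` invariant (`η`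
Markov) then `refreshUpdateK κ η` leaves `μ` invariant. -/
theorem refreshUpdateK_invariant {κ : ProbabilityTheory.Kernel (Ω × P) (Ω × P)} {μ : Measure Ω} [SFinite μ]
    {η : ProbabilityTheory.Kernel Ω P} [ProbabilityTheory.IsMarkovKernel η]
    (hκ : ProbabilityTheory.Kernel.Invariant κ (μ ⊗ₘ η)) :
    ProbabilityTheory.Kernel.Invariant (refreshUpdateK κ η) μ := by
  change refreshUpdateK κ η ∘ₘ μ = μ
  rw [refreshUpdateK, ← Measure.map_comp _ _ measurable_fst, ← Measure.comp_assoc,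
    ← Measure.compProd_eq_comp_prod, hκ.def]
  exact Measure.fst_compProd μ η

end KernelRefresh

section TangentLaw

open ProbabilityTheory

variable {m : Type*} [Fintype m] [DecidableEq m]

/-- **The tangent momentum law**: at `u ∈ S`, the image of a momentum law `μP` on `ℝ^d` under the
tangential projection `p ↦ p − ⟪u,p⟫u` (for the standard Gaussian: the tangent-space Gaussian the
CP(N−1) code draws), as a Markov kernel `S → ℝ^d`. -/
def tangentMomentumLaw (μP : Measure (EuclideanSpace ℝ m)) : ProbabilityTheory.Kernel (sphere (0 : EuclideanSpace ℝ m) 1) (EuclideanSpace ℝ m) :=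
  ProbabilityTheory.Kernel.map (ProbabilityTheory.Kernel.id ×ₖ ProbabilityTheory.Kernel.const (sphere (0 : EuclideanSpace ℝ m) 1) μP)
    (tangentialPart : (sphere (0 : EuclideanSpace ℝ m) 1) × (EuclideanSpace ℝ m) → (EuclideanSpace ℝ m))

omit [DecidableEq m] in
/-- Its value at `u` is the image law. -/
theorem tangentMomentumLaw_apply (μP : Measure (EuclideanSpace ℝ m)) [SFinite μP] (u : (sphere (0 : EuclideanSpace ℝ m) 1)) :
    tangentMomentumLaw μP u = μP.map fun p : (EuclideanSpace ℝ m) => tangentialPart (u, p) := by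
  rw [tangentMomentumLaw, ProbabilityTheory.Kernel.map_apply _ continuous_tangentialPart.measurable,
    ProbabilityTheory.Kernel.prod_apply, ProbabilityTheory.Kernel.id_apply,
    ProbabilityTheory.Kernel.const_apply, Measure.dirac_prod,
    Measure.map_map continuous_tangentialPart.measurable measurable_prodMk_left]
  rfl

omit [DecidableEq m] in
/-- It is an s-finite kernel for an s-finite law `μP`. -/
instance tangentMomentumLaw.isSFiniteKernel (μP : Measure (EuclideanSpace ℝ m)) [SFinite μP] :
    ProbabilityTheory.IsSFiniteKernel (tangentMomentumLaw μP) := by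
  unfold tangentMomentumLaw
  infer_instance

omit [DecidableEq m] in
/-- It is a Markov kernel for a probability law `μP`. -/
instance tangentMomentumLaw.isMarkovKernel (μP : Measure (EuclideanSpace ℝ m)) [IsProbabilityMeasure μP] :
    ProbabilityTheory.IsMarkovKernel (tangentMomentumLaw μP) := by
  unfold tangentMomentumLaw
  exact ProbabilityTheory.Kernel.IsMarkovKernel.map _ continuous_tangentialPart.measurable

variable [Nonempty m]

/-- **THMC/HMC as the CP(N−1) code runs it = the exact ambient chain.**  For a tangent force and the
Gaussian kinetic energy, the configuration kernel of the sphere HMC with momenta refreshed from a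
law `μP` on the ambient `ℝ^d` EQUALS the configuration kernel with momenta refreshed from the
TANGENT law `tangentMomentumLaw μP` (position-dependent).  With `sphere_hmc_gaussian_exact` this
says: the chain the code runs (tangent Gaussian momenta) leaves `e^{−S}·uniformSphere` invariant. -/
theorem sphereHMC_config_eq_tangentRefresh (h2 : 2 ≤ Fintype.card m) {S : (sphere (0 : EuclideanSpace ℝ m) 1) → ℝ} (hS : Measurable S)
    {F : (EuclideanSpace ℝ m) → (EuclideanSpace ℝ m)} (hFm : Measurable F) (hF : ∀ x : (sphere (0 : EuclideanSpace ℝ m) 1), ⟪(x : (EuclideanSpace ℝ m)), F x⟫_ℝ = 0) (δ : ℝ) (n : ℕ)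
    (μP : Measure (EuclideanSpace ℝ m)) [SFinite μP] :
    refreshUpdate
        (involMH ⇑((flipPerm : Equiv.Perm ((sphere (0 : EuclideanSpace ℝ m) 1) × (EuclideanSpace ℝ m))) * leapfrogPerm F δ ^ n)
          (measurePreserving_sphereProposal h2 hFm δ n).measurable
          (fun w : (sphere (0 : EuclideanSpace ℝ m) 1) × (EuclideanSpace ℝ m) => S w.1 + ‖w.2‖ ^ 2 / 2)) μP =
      refreshUpdateK
        (involMH ⇑((flipPerm : Equiv.Perm ((sphere (0 : EuclideanSpace ℝ m) 1) × (EuclideanSpace ℝ m))) * leapfrogPerm F δ ^ n)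
          (measurePreserving_sphereProposal h2 hFm δ n).measurable
          (fun w : (sphere (0 : EuclideanSpace ℝ m) 1) × (EuclideanSpace ℝ m) => S w.1 + ‖w.2‖ ^ 2 / 2)) (tangentMomentumLaw μP) := by
  ext u A hA
  rw [sphereHMC_config_apply_eq_lintegral_tangential h2 hS hFm hF δ n μP u hA,
    refreshUpdateK_apply' _ _ u hA, tangentMomentumLaw_apply]

/-- **Hence the tangent-momentum chain is exact**: with the standard Gaussian weight on `ℝ^d`
projected to the tangent spaces (the code's momentum draw), the configuration chain leaves
`e^{−S}·uniformSphere` invariant. -/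
theorem sphere_hmc_tangentGaussian_exact (h2 : 2 ≤ Fintype.card m) {S : (sphere (0 : EuclideanSpace ℝ m) 1) → ℝ} (hS : Measurable S)
    {F : (EuclideanSpace ℝ m) → (EuclideanSpace ℝ m)} (hFm : Measurable F) (hF : ∀ x : (sphere (0 : EuclideanSpace ℝ m) 1), ⟪(x : (EuclideanSpace ℝ m)), F x⟫_ℝ = 0) (δ : ℝ) (n : ℕ) :
    ProbabilityTheory.Kernel.Invariant
      (refreshUpdateK
        (involMH ⇑((flipPerm : Equiv.Perm ((sphere (0 : EuclideanSpace ℝ m) 1) × (EuclideanSpace ℝ m))) * leapfrogPerm F δ ^ n)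
          (measurePreserving_sphereProposal h2 hFm δ n).measurable
          (fun w : (sphere (0 : EuclideanSpace ℝ m) 1) × (EuclideanSpace ℝ m) => S w.1 + ‖w.2‖ ^ 2 / 2))
        (tangentMomentumLaw
          ((((volume : Measure (EuclideanSpace ℝ m)).withDensity
              (fun p => ENNReal.ofReal (Real.exp (-(‖p‖ ^ 2 / 2)))) Set.univ)⁻¹ •
            (volume : Measure (EuclideanSpace ℝ m)).withDensity (fun p => ENNReal.ofReal (Real.exp (-(‖p‖ ^ 2 / 2))))))))
      ((uniformSphere (volume : Measure (EuclideanSpace ℝ m))).withDensity fun x => ENNReal.ofReal (Real.exp (-S x))) := by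
  rw [← sphereHMC_config_eq_tangentRefresh h2 hS hFm hF δ n]
  exact sphere_hmc_gaussian_exact h2 hS hFm δ n

end TangentLaw

end Summit.Ventures.LatticeQCDFlow.Exactness

end
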